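import Mathlib.Analysis.InnerProductSpace.Calculus
import Mathlib.Analysis.Calculus.Deriv.Mul
import Mathlib.Analysis.Calculus.Deriv.Pow
import Literature.Topology.FourManifolds.SliceRibbon
import Literature.Topology.FourManifolds.DehnSurgeryTubularNbhdProofs
import HarnessLib

/-!
# Cones over level families; isotopic knots are concordant; concordance is reflexive

Sibling proof file of `SliceRibbon.lean` (topic `Literature/Topology/FourManifolds`; D-0014: named
facts `def X : Prop` are discharged as `theorem X_holds : X`). It discharges

* `Literature.Knot.IsConcordant.of_isIsotopic_holds : Knot.IsConcordant.of_isIsotopic` — ambient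
  isotopic knots `K ≅ K'` in `𝕊 3` are smoothly concordant (Livingston, *A survey of classical
  knot concordance* (2005), §2.1; Fox–Milnor (1966), §1),

proves **reflexivity of concordance** unconditionally (`Literature.Topology.FourManifolds.Knot.IsConcordant.refl'`; one third of
the named fact `Literature.Topology.FourManifolds.equivalence_isConcordant`, whose in-file corollary `Knot.IsConcordant.refl`
takes the fact as a hypothesis), and provides the infrastructure lemma behind both, used again by
the collar normal form of concordances (programme of `BandSumConcordance.lean`):

* `Literature.Knot.coneMap Φ (x, t) = t • Φ (x, t) ∈ ℝ⁴`, the **cone** over a *level family*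
  `Φ : 𝕊 1 × ℝ → 𝕊 3` (the curve `Φ (·, t)` traced on the sphere of radius `t`);
* `Literature.Topology.FourManifolds.Knot.isConcordance_coneMap`: if `Φ` is jointly smooth and every level `Φ (·, t)`,
  `t ∈ [1, 2]`, is an injective immersion, the cone is a concordance (`Literature.Topology.FourManifolds.Knot.IsConcordance`)
  from `Φ (·, 1)` to `Φ (·, 2)` — *a level-preserving isotopy through embeddings is a
  concordance*. The radius of the cone is `t`, whence the shell condition, neatness
  (`d/dt ‖·‖² = 2t > 0`) and, with injectivity of the levels, injectivity on `𝕊 1 × [1, 2]`. The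
  only non-formal point is that the cone is an immersion (`Literature.Topology.FourManifolds.Knot.injective_mfderiv_coneMap`):
  at `(x, t)`, `t ≠ 0`, its differential (`mfderiv_prod_eq_add_apply`) sends `(v, σ)` to
  `t • dι (d_xΦ v) + σ • (P + t • γ' (t))` with `P = Φ (x, t)`, `γ (s) = Φ (x, s)`,
  `ι : 𝕊 3 → ℝ⁴`; both `dι (d_xΦ v)` and `γ' (t)` are tangent to `𝕊 3` at `P`
  (`range_mfderiv_coe_sphere`, resp. `‖γ‖ = 1`), so pairing with `P` gives `σ = 0`, and then
  `v = 0` (`mfderiv_coe_sphere_injective` and the hypothesis on `d_xΦ`).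

Applications: the constant family `Φ (x, t) = K x` gives the radial annulus and reflexivity
(`isConcordance_coneMap_self`, `IsConcordant.refl'`; the level differential is injective by
`Literature.Topology.FourManifolds.mfderiv_injective_of_isImmersion`, the knot being an immersion); the family
`Φ (x, t) = F_{t-1} (K x)` of an ambient isotopy `F` with `F₁ ∘ K = K'` gives the **trace
annulus** `Literature.Knot.isotopyTrace F K` and the discharge (`isConcordance_isotopyTrace`,
`IsConcordant.of_isIsotopic_holds`; the level differential `dF_{t-1} ∘ dK` is injective since the
stages of `F` are local diffeomorphisms). No reparametrisation flat at the ends is needed because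
`IsConcordance` asks for a map on `𝕊 1 × ℝ` without product collars.

## References

* C. Livingston, *A survey of classical knot concordance*, Handbook of Knot Theory (2005), §2.1,
  Thm. 2.1 (concordance is an equivalence relation), Thm. 2.2.
* R. H. Fox, J. W. Milnor, *Singularities of 2-spheres in 4-space and cobordism of knots*,
  Osaka J. Math. 3 (1966), 257–267, §1.
-/

open scoped Manifold ContDiff Topology
open Function Set

noncomputable section

namespace Literature.Topology.FourManifolds

attribute [local instance] fact_finrank_euclideanSpace_two fact_finrank_euclideanSpace_four

/-- Local notation: `𝔼 n` is the model Euclidean space `EuclideanSpace ℝ (Fin n)`. -/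
local notation "𝔼 " n:arg => EuclideanSpace ℝ (Fin n)

/-- Local notation: `𝕊 n` is the unit sphere in `EuclideanSpace ℝ (Fin (n + 1))`. -/
local notation "𝕊 " n:arg => (Metric.sphere (0 : EuclideanSpace ℝ (Fin (n + 1))) 1)

namespace Knot

variable (Φ : (𝕊 1) × ℝ → 𝕊 3)

/-- The **cone** over a level family `Φ : 𝕊 1 × ℝ → 𝕊 3`: `(x, t) ↦ t • Φ (x, t) ∈ ℝ⁴`, the
curve `Φ (·, t)` traced on the sphere of radius `t`. Livingston (2005), §2.1 (the trace of a
level-preserving isotopy in `S³ × I`, read radially). [folklore] -/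
def coneMap (p : (𝕊 1) × ℝ) : 𝔼 4 :=
  p.2 • ((Φ p : 𝕊 3) : 𝔼 4)

/-- The cone map in coordinates (definitional). [folklore] -/
theorem coneMap_apply (x : 𝕊 1) (t : ℝ) : coneMap Φ (x, t) = t • ((Φ (x, t) : 𝕊 3) : 𝔼 4) :=
  rfl

/-- `‖cone (x, t)‖ = |t|`. [folklore] -/
theorem norm_coneMap (x : 𝕊 1) (t : ℝ) : ‖coneMap Φ (x, t)‖ = |t| := by
  rw [coneMap_apply, norm_smul, norm_eq_of_mem_sphere, mul_one, Real.norm_eq_abs]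

/-- `‖cone (x, ·)‖ ^ 2 = (·) ^ 2`. [folklore] -/
theorem norm_coneMap_sq (x : 𝕊 1) : (fun t ↦ ‖coneMap Φ (x, t)‖ ^ 2) = fun t ↦ t ^ 2 := by
  funext t
  rw [norm_coneMap, sq_abs]

/-- `d/dt ‖cone (x, t)‖ ^ 2 = 2 t`. [folklore] -/
theorem deriv_norm_coneMap_sq (x : 𝕊 1) (t : ℝ) :
    deriv (fun t ↦ ‖coneMap Φ (x, t)‖ ^ 2) t = 2 * t := by
  rw [norm_coneMap_sq, (hasDerivAt_pow 2 t).deriv]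
  norm_num

/-- The cone over a smooth level family is jointly `C^∞`. [folklore] -/
theorem contMDiff_coneMap (hΦ : ContMDiff ((𝓡 1).prod 𝓘(ℝ, ℝ)) (𝓡 3) ∞ Φ) :
    ContMDiff ((𝓡 1).prod 𝓘(ℝ, ℝ)) 𝓘(ℝ, 𝔼 4) ∞ (coneMap Φ) :=
  contMDiff_snd.smul ((contMDiff_coe_sphere (n := 3)).comp hΦ)

/-- The cone is injective on `𝕊 1 × [1, 2]` as soon as the levels `Φ (·, t)`, `t ∈ [1, 2]`, are
injective (the radius recovers `t`). [folklore] -/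
theorem injOn_coneMap (hinj : ∀ t ∈ Icc (1 : ℝ) 2, Injective fun x ↦ Φ (x, t)) :
    InjOn (coneMap Φ) (univ ×ˢ Icc 1 2) := by
  rintro ⟨x, t⟩ ⟨-, ht⟩ ⟨x', t'⟩ ⟨-, ht'⟩ h
  have ht0 : 0 < t := one_pos.trans_le ht.1
  have ht0' : 0 < t' := one_pos.trans_le ht'.1
  have htt : t = t' := by
    have hn := congrArg (fun z ↦ ‖z‖) h
    simpa only [norm_coneMap, abs_of_pos ht0, abs_of_pos ht0'] using hn
  subst htt
  rw [coneMap_apply, coneMap_apply] at h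
  have h1 := smul_right_injective (𝔼 4) ht0.ne' h
  have h2 : Φ (x, t) = Φ (x', t) := Subtype.ext h1
  rw [hinj t ht h2]

/-- **The cone over a level family of immersions is an immersion** (away from `t = 0`): if `Φ`
is jointly smooth and the level `Φ (·, t)` has injective differential at `x`, then so has the
cone at `(x, t)`, `t ≠ 0`. Its differential sends `(v, σ)` to
`t • dι (d_xΦ v) + σ • (P + t • γ' (t))`, `P = Φ (x, t)`, `γ (s) = Φ (x, s)`; the vectors
`dι (d_xΦ v)` and `γ' (t)` are tangent to `𝕊 3` at `P`, so pairing with `P` forces `σ = 0`,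
and then `v = 0` since `dι` and `d_xΦ` are injective. [folklore] -/
theorem injective_mfderiv_coneMap (hΦ : ContMDiff ((𝓡 1).prod 𝓘(ℝ, ℝ)) (𝓡 3) ∞ Φ) (x : 𝕊 1)
    {t : ℝ} (ht : t ≠ 0) (hx : Injective (mfderiv (𝓡 1) (𝓡 3) (fun z : 𝕊 1 ↦ Φ (z, t)) x)) :
    Injective (mfderiv ((𝓡 1).prod 𝓘(ℝ, ℝ)) 𝓘(ℝ, 𝔼 4) (coneMap Φ) (x, t)) := by
  have hn0 : (∞ : ℕ∞ω) ≠ 0 := by simp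
  -- the point `P` and the curve `γ` through it
  set P : 𝕊 3 := Φ (x, t) with hP
  set γ : ℝ → 𝔼 4 := fun s ↦ ((Φ (x, s) : 𝕊 3) : 𝔼 4) with hγ
  have hγ_smooth : ContMDiff 𝓘(ℝ, ℝ) 𝓘(ℝ, 𝔼 4) ∞ γ :=
    (contMDiff_coe_sphere (n := 3)).comp (hΦ.comp (contMDiff_const.prodMk contMDiff_id))
  have hγd : DifferentiableAt ℝ γ t := (hγ_smooth.contDiff.differentiable hn0) t
  have hγt : γ t = (P : 𝔼 4) := rfl
  -- `γ` stays on the unit sphere, so `γ' ⟂ γ`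
  have hW : inner ℝ (P : 𝔼 4) (deriv γ t) = 0 := by
    have h1 : HasDerivAt (fun s ↦ ‖γ s‖ ^ 2) (2 * inner ℝ (γ t) (deriv γ t)) t :=
      hγd.hasDerivAt.norm_sq
    have h2 : (fun s ↦ ‖γ s‖ ^ 2) = fun _ ↦ (1 : ℝ) := by
      funext s
      rw [hγ]
      simp only [norm_eq_of_mem_sphere, one_pow]
    rw [h2] at h1
    have h3 : (2 : ℝ) * inner ℝ (γ t) (deriv γ t) = 0 := h1.unique (hasDerivAt_const t 1)
    rw [hγt] at h3
    linarith
  -- the level differential `d_xΦ` and `dι`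
  set DΦ := mfderiv (𝓡 1) (𝓡 3) (fun z : 𝕊 1 ↦ Φ (z, t)) x with hDΦ
  set Dι := mfderiv (𝓡 3) 𝓘(ℝ, 𝔼 4) (Subtype.val : (𝕊 3) → 𝔼 4) P with hDι
  have hι_inj : Injective Dι := mfderiv_coe_sphere_injective (n := 3) P
  have hΦt : ContMDiff (𝓡 1) (𝓡 3) ∞ (fun z : 𝕊 1 ↦ Φ (z, t)) :=
    hΦ.comp (contMDiff_id.prodMk contMDiff_const)
  have hΦd : HasMFDerivAt (𝓡 1) (𝓡 3) (fun z : 𝕊 1 ↦ Φ (z, t)) x DΦ :=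
    (hΦt.mdifferentiableAt hn0).hasMFDerivAt
  have hιd : HasMFDerivAt (𝓡 3) 𝓘(ℝ, 𝔼 4) (Subtype.val : (𝕊 3) → 𝔼 4) P Dι :=
    ((contMDiff_coe_sphere (n := 3)).mdifferentiableAt hn0).hasMFDerivAt
  have hGd : HasMFDerivAt (𝓡 1) 𝓘(ℝ, 𝔼 4) (Subtype.val ∘ fun z : 𝕊 1 ↦ Φ (z, t)) x
      (Dι.comp DΦ) :=
    hιd.comp x hΦd
  -- the partial derivative in `x`
  have hA : mfderiv (𝓡 1) 𝓘(ℝ, 𝔼 4) (fun z : 𝕊 1 ↦ coneMap Φ (z, t)) x = t • Dι.comp DΦ := by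
    have heq : (fun z : 𝕊 1 ↦ coneMap Φ (z, t)) = t • (Subtype.val ∘ fun z : 𝕊 1 ↦ Φ (z, t)) :=
      rfl
    rw [heq, const_smul_mfderiv hGd.mdifferentiableAt, hGd.mfderiv]
    rfl
  -- the partial derivative in `t`
  have hd2 : HasDerivAt (fun s : ℝ ↦ s • γ s) (t • deriv γ t + (1 : ℝ) • γ t) t :=
    (hasDerivAt_id' t).smul hγd.hasDerivAt
  have hB : ∀ σ : ℝ, mfderiv 𝓘(ℝ, ℝ) 𝓘(ℝ, 𝔼 4) (fun s : ℝ ↦ coneMap Φ (x, s)) t σ =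
      σ • (t • deriv γ t + (1 : ℝ) • γ t) := by
    intro σ
    have heq : (fun s : ℝ ↦ coneMap Φ (x, s)) = fun s ↦ s • γ s := rfl
    rw [heq, mfderiv_eq_fderiv, hd2.hasFDerivAt.fderiv]
    rfl
  -- the total differential
  have hf : MDifferentiableAt ((𝓡 1).prod 𝓘(ℝ, ℝ)) 𝓘(ℝ, 𝔼 4) (coneMap Φ) (x, t) :=
    (contMDiff_coneMap Φ hΦ).mdifferentiableAt hn0
  rw [injective_iff_map_eq_zero]
  intro v hv
  obtain ⟨U, hUdef⟩ : ∃ U : 𝔼 4, U = Dι (DΦ v.1) := ⟨_, rfl⟩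
  have key : mfderiv ((𝓡 1).prod 𝓘(ℝ, ℝ)) 𝓘(ℝ, 𝔼 4) (coneMap Φ) (x, t) v =
      t • U + v.2 • (t • deriv γ t + (1 : ℝ) • (P : 𝔼 4)) := by
    rw [mfderiv_prod_eq_add_apply hf]
    dsimp only
    rw [hA, hB, hUdef]
    rfl
  rw [key] at hv
  -- the same equation in `ℝ⁴` (the tangent space `T ℝ⁴` is `ℝ⁴` by definition)
  have hv' : t • U + v.2 • (t • deriv γ t + (1 : ℝ) • (P : 𝔼 4)) = (0 : 𝔼 4) := hv
  -- pair with `P`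
  have hU : inner ℝ (P : 𝔼 4) U = 0 := by
    have hmem : U ∈ (ℝ ∙ (P : 𝔼 4))ᗮ := by
      rw [hUdef, ← range_mfderiv_coe_sphere (n := 3) P]
      exact ⟨DΦ v.1, rfl⟩
    exact (Submodule.mem_orthogonal_singleton_iff_inner_right).mp hmem
  have hPP : inner ℝ (P : 𝔼 4) (P : 𝔼 4) = 1 := by
    rw [real_inner_self_eq_norm_sq, norm_eq_of_mem_sphere, one_pow]
  have h2 : v.2 = 0 := by
    have h := congrArg (fun z ↦ inner ℝ (P : 𝔼 4) z) hv'
    simp only [inner_add_right, inner_smul_right, inner_zero_right, hU, hW, hPP] at h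
    linarith
  rw [h2, zero_smul, add_zero] at hv'
  have hU0 : U = 0 := (smul_eq_zero.mp hv').resolve_left ht
  rw [hUdef] at hU0
  have e1 : DΦ v.1 = 0 := (injective_iff_map_eq_zero Dι).1 hι_inj _ hU0
  have e2 : v.1 = 0 := (injective_iff_map_eq_zero DΦ).1 hx _ e1
  exact Prod.ext e2 h2

variable {Φ}

/-- **The cone over a level-preserving family of embedded circles is a concordance.** If
`Φ : 𝕊 1 × ℝ → 𝕊 3` is jointly smooth, every level `Φ (·, t)`, `t ∈ [1, 2]`, is an injective
immersion, `Φ (·, 1) = K` and `Φ (·, 2) = K'`, then `(x, t) ↦ t • Φ (x, t)` is a concordance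
from `K` to `K'` (`IsConcordance`: the radius is `t`, whence the shell condition and neatness
`d/dt ‖·‖² = 2t > 0`). Livingston (2005), §2.1 (isotopic knots are concordant via the trace of
the isotopy). [cite: Livingston2005, §2.1] -/
theorem isConcordance_coneMap {K K' : Knot} (hΦ : ContMDiff ((𝓡 1).prod 𝓘(ℝ, ℝ)) (𝓡 3) ∞ Φ)
    (hinj : ∀ t ∈ Icc (1 : ℝ) 2, Injective fun x ↦ Φ (x, t))
    (himm : ∀ t ∈ Icc (1 : ℝ) 2, ∀ x,
      Injective (mfderiv (𝓡 1) (𝓡 3) (fun z : 𝕊 1 ↦ Φ (z, t)) x))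
    (h1 : ∀ x, Φ (x, 1) = K x) (h2 : ∀ x, Φ (x, 2) = K' x) :
    IsConcordance K K' (coneMap Φ) := by
  refine ⟨contMDiff_coneMap Φ hΦ, injOn_coneMap Φ hinj, ?_, ?_, ?_, ?_, ?_⟩
  · rintro ⟨x, t⟩ ⟨-, ht⟩
    exact injective_mfderiv_coneMap Φ hΦ x (one_pos.trans_le ht.1).ne' (himm t ht x)
  · intro x t ht
    rw [norm_coneMap, abs_of_pos (one_pos.trans ht.1)]
    exact ht
  · intro x
    rw [deriv_norm_coneMap_sq, deriv_norm_coneMap_sq]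
    norm_num
  · intro x
    rw [coneMap_apply, one_smul, h1]
  · intro x
    rw [coneMap_apply, h2]

/-- Existence form of `isConcordance_coneMap`: knots joined by a level-preserving family of
embedded circles are concordant. [cite: Livingston2005, §2.1] -/
theorem isConcordant_of_levelFamily {K K' : Knot} (Φ : (𝕊 1) × ℝ → 𝕊 3)
    (hΦ : ContMDiff ((𝓡 1).prod 𝓘(ℝ, ℝ)) (𝓡 3) ∞ Φ)
    (hinj : ∀ t ∈ Icc (1 : ℝ) 2, Injective fun x ↦ Φ (x, t))
    (himm : ∀ t ∈ Icc (1 : ℝ) 2, ∀ x,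
      Injective (mfderiv (𝓡 1) (𝓡 3) (fun z : 𝕊 1 ↦ Φ (z, t)) x))
    (h1 : ∀ x, Φ (x, 1) = K x) (h2 : ∀ x, Φ (x, 2) = K' x) : K.IsConcordant K' :=
  ⟨coneMap Φ, isConcordance_coneMap hΦ hinj himm h1 h2⟩

/-! ### Reflexivity of concordance -/

/-- The **radial annulus** `(x, t) ↦ t • K x` over a knot is a concordance from `K` to itself
(the cone over the constant family). Fox–Milnor (1966), §1; Livingston (2005), Thm. 2.1.
[cite: FoxMilnor1966, §1] -/
theorem isConcordance_coneMap_self (K : Knot) :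
    IsConcordance K K (coneMap fun p : (𝕊 1) × ℝ ↦ K p.1) := by
  have hn1 : (1 : ℕ∞ω) ≤ ∞ := by exact_mod_cast le_top
  refine isConcordance_coneMap (K.contMDiff.comp contMDiff_fst) (fun t _ ↦ K.injective)
    (fun t _ x ↦ ?_) (fun x ↦ rfl) (fun x ↦ rfl)
  exact mfderiv_injective_of_isImmersion K.isSmoothEmbedding.isImmersion hn1 x

/-- **Concordance is reflexive**, unconditionally (the version `IsConcordant.refl` of
`SliceRibbon.lean` takes the named fact `equivalence_isConcordant` as a hypothesis).
Fox–Milnor (1966), §1; Livingston (2005), Thm. 2.1. [cite: FoxMilnor1966, §1] -/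
theorem IsConcordant.refl' (K : Knot) : K.IsConcordant K :=
  ⟨_, isConcordance_coneMap_self K⟩

/-! ### The trace of an ambient isotopy: isotopic knots are concordant -/

section Trace

variable (F : AmbientIsotopy (𝓡 3) (𝕊 3)) (K : Knot)

/-- The level family `(x, t) ↦ F_{t-1} (K x)` of an ambient isotopy `F` of `𝕊 3` applied to the
knot `K`. [folklore] -/
def isotopyFamily (p : (𝕊 1) × ℝ) : 𝕊 3 :=
  F.toFun (p.2 - 1) (K p.1)

/-- The **trace annulus** of an ambient isotopy `F` of `𝕊 3` applied to the knot `K`: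
`(x, t) ↦ t • F_{t-1} (K x) ∈ ℝ⁴`, the cone over `isotopyFamily F K`; on `𝕊 1 × [1, 2]` it
runs from `K` (radius `1`, `F₀ = id`) to `2 • (F₁ ∘ K)` (radius `2`). Livingston (2005), §2.1.
[cite: Livingston2005, §2.1] -/
def isotopyTrace : (𝕊 1) × ℝ → 𝔼 4 :=
  coneMap (isotopyFamily F K)

/-- The trace annulus in coordinates (definitional). [folklore] -/
theorem isotopyTrace_apply (x : 𝕊 1) (t : ℝ) :
    isotopyTrace F K (x, t) = t • ((F.toFun (t - 1) (K x) : 𝕊 3) : 𝔼 4) := rfl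

/-- The level family of an ambient isotopy is jointly `C^∞`. [folklore] -/
theorem contMDiff_isotopyFamily :
    ContMDiff ((𝓡 1).prod 𝓘(ℝ, ℝ)) (𝓡 3) ∞ (isotopyFamily F K) := by
  have h2 : ContMDiff ((𝓡 1).prod 𝓘(ℝ, ℝ)) (𝓘(ℝ, ℝ).prod (𝓡 3)) ∞
      (fun p : (𝕊 1) × ℝ ↦ (p.2 - 1, K p.1)) :=
    ((contDiff_id.sub contDiff_const).comp_contMDiff contMDiff_snd).prodMk
      (K.contMDiff.comp contMDiff_fst)
  exact F.contMDiff.comp h2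

/-- Every level `x ↦ F_{t-1} (K x)` is injective (a bijective stage after an embedding).
[folklore] -/
theorem injective_isotopyFamily (t : ℝ) : Injective fun x ↦ isotopyFamily F K (x, t) :=
  fun _ _ h ↦ K.injective ((F.bijective (t - 1)).1 h)

/-- Every level `x ↦ F_{t-1} (K x)` is an immersion: its differential `dF_{t-1} ∘ dK` is
injective (`F_{t-1}` is a local diffeomorphism, `K` an immersion:
`Literature.Topology.FourManifolds.mfderiv_injective_of_isImmersion`). [folklore] -/
theorem injective_mfderiv_isotopyFamily (t : ℝ) (x : 𝕊 1) :
    Injective (mfderiv (𝓡 1) (𝓡 3) (fun z : 𝕊 1 ↦ isotopyFamily F K (z, t)) x) := by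
  have hn0 : (∞ : ℕ∞ω) ≠ 0 := by simp
  have hn1 : (1 : ℕ∞ω) ≤ ∞ := by exact_mod_cast le_top
  have hK_inj : Injective (mfderiv (𝓡 1) (𝓡 3) (⇑K) x) :=
    mfderiv_injective_of_isImmersion K.isSmoothEmbedding.isImmersion hn1 x
  have hloc := (F.isLocalDiffeomorph (t - 1)) (K x)
  have hF_inj : Injective (mfderiv (𝓡 3) (𝓡 3) (F.toFun (t - 1)) (K x)) := by
    rw [← hloc.mfderivToContinuousLinearEquiv_coe hn0, ContinuousLinearEquiv.coe_coe]
    exact (hloc.mfderivToContinuousLinearEquiv hn0).injective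
  have heq : (fun z : 𝕊 1 ↦ isotopyFamily F K (z, t)) = F.toFun (t - 1) ∘ ⇑K := rfl
  rw [heq, mfderiv_comp x ((F.contMDiff_toFun (t - 1)).mdifferentiableAt hn0)
    (K.contMDiff.mdifferentiableAt hn0)]
  exact hF_inj.comp hK_inj

variable {F K}

/-- **The trace annulus of an ambient isotopy is a concordance** from `K` to `F₁ ∘ K`.
Livingston (2005), §2.1. [cite: Livingston2005, §2.1] -/
theorem isConcordance_isotopyTrace {K' : Knot} (hF : F.toFun 1 ∘ ⇑K = ⇑K') :
    IsConcordance K K' (isotopyTrace F K) := by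
  refine isConcordance_coneMap (contMDiff_isotopyFamily F K)
    (fun t _ ↦ injective_isotopyFamily F K t) (fun t _ x ↦ injective_mfderiv_isotopyFamily F K t x)
    (fun x ↦ ?_) (fun x ↦ ?_)
  · show F.toFun (1 - 1) (K x) = K x
    rw [sub_self, F.map_zero, id]
  · show F.toFun (2 - 1) (K x) = K' x
    rw [show (2 : ℝ) - 1 = 1 by norm_num, ← hF]
    rfl

/-- **Isotopic knots are concordant** — discharge of the named fact
`Knot.IsConcordant.of_isIsotopic` (`SliceRibbon.lean`): the trace annulus
`(x, t) ↦ t • F_{t-1} (K x)` of an ambient isotopy `F` with `F₁ ∘ K = K'` is a concordance from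
`K` to `K'`. Livingston (2005), §2.1. [cite: Livingston2005, §2.1] -/
theorem IsConcordant.of_isIsotopic_holds : IsConcordant.of_isIsotopic := by
  intro K K' h
  obtain ⟨F, hF⟩ := h
  exact ⟨isotopyTrace F K, isConcordance_isotopyTrace hF⟩

end Trace

end Knot

end Literature.Topology.FourManifolds
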